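import Summits.NavierStokesRegularity.NavierStokesRegularity.Theses.AxisymmetricExtremality
import Literature.Analysis.FluidPDE.CKNInterpolationEstimate
import HarnessLib

/-!
# Seregin 2020, proof of Thm 2.1, (2.10): the scaled `L⁴_t L³_x` bound from `A` and `E`

Helper toward the stub `stub_seregin2020TypeII` of the crux `AxisymmetricKatoGlobal` (= the named
fact `Literature.Analysis.FluidPDE.Seregin2020_axisymmetricSingularPoint_typeII`, G. Seregin,
Anal. Math. Phys. 10 (2020) Paper 46 = arXiv:2006.04140, Thm 2.1). In the printed proof (arXiv
p. 8) the ancient blow-up limit `u` has bounded scaled energies `A(u,R) + E(u,R) + ⋯ ≤ L₀` at every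
scale ((𝒜)(iii)), and "by the known multiplicative inequalities and by (𝒜)(iii), we have
(2.10) `sup_{R>0} R^{-1/2} (∫_{-R²}^0 (∫_{𝒞(R)} |u|³ dx)^{4/3} dt)^{1/4} ≤ c(L₀)`", the quantity
`N_R` that enters the weak Harnack Lemma 2.2. This file proves the inequality behind (2.10) in the
tree's vocabulary (balls `B(x, a)` and the scaled quantities `cknAEss`, `cknE`): there is an
absolute constant `C₀` such that for every field `w` with weak spatial gradient `G` on the
parabolic cylinder `Q(z, a) = (t - a², t) × B(x, a)` and `A(w; Q(z,a)) ≤ K`, `E(G; Q(z,a)) ≤ K`,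

  `∫_{t-a²}^{t} (∫_{B(x,a)} |w|³ dy)^{4/3} ds ≤ C₀ a² K²`

(`exists_lintegral_cube_fourThirds_le`; at the origin
`lintegral_cube_fourThirds_le_of_cknAEss_cknE`), i.e.
`a^{-1/2} ‖w‖_{L⁴_t L³_x (Q(a))} ≤ C₀^{1/4} K^{1/2}` uniformly in `a`, which is (2.10).

## Proof

At unit scale (`exists_lintegral_cube_fourThirds_unit_le`), exactly as in the tree's proof of
the interpolation inequality `C ≤ C₀ (A + E)^{3/2}` (`CKNInterpolationEstimate.lean`,
Robinson–Rodrigo–Sadowski 2016, Lemma 15.10): for a.e. `s ∈ (-1, 0)` the slice `w(s)` has the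
weak derivative `G(s)` on `B₁` (`HasWeakSpatialGradientOn.ae_hasWeakFDerivOn_ball`), so by the
Sobolev inequality on the unit ball (`exists_eLpNorm_six_le_unitBall`) and Lebesgue interpolation
`∫ |w|³ ≤ (∫ |w|²)^{3/4} (∫ |w|⁶)^{1/4}` (`lintegral_pow_three_le_Lp_interpolation`),
`∫_{B₁} |w(s)|³ ≤ A^{3/4} (2 C_S)^{3/2} (a(s) + e(s))^{3/4}` with `a(s) = ∫_{B₁} |w(s)|²`,
`e(s) = ∫_{B₁} |G(s)|²`; raising to the power `4/3` and integrating in `s`,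
`∫_{-1}^0 (∫_{B₁} |w|³)^{4/3} ≤ (2 C_S)² A (A + E) ≤ 2 (2 C_S)² K²`. The general cylinder follows
by the Navier–Stokes scaling `w ↦ a w(t + a² s, x + a y)` (`cknAEss_nsZoom`, `cknE_nsZoom`,
`HasWeakSpatialGradientOn.stRescale`) and the scaling law of the mixed norm
(`lintegral_cube_fourThirds_nsZoom`: the quantity scales like `a²`).

## References

* G. Seregin, Anal. Math. Phys. 10 (2020), Paper 46 = arXiv:2006.04140, proof of Thm. 2.1,
  (2.10). [Seregin2020]
* J. C. Robinson, J. L. Rodrigo, W. Sadowski, *The three-dimensional Navier–Stokes equations*,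
  CUP (2016), Lemma 15.10, Lemma 3.5.
-/

-- the problem directory repeats the summit name (D-0017); core's `dupNamespace` linter fires
set_option linter.dupNamespace false

noncomputable section

open MeasureTheory Set Function Filter Topology TopologicalSpace Metric Module
open scoped NNReal ENNReal

namespace Summit.NavierStokesRegularity.NavierStokesRegularity.Theorems.AxisymmetricKatoGlobal.EulerScaling

open Literature.Analysis.FluidPDE

/-! ### Scaling of the mixed norm `∫ (∫_{B} |w|³)^{4/3}` -/

/-- Time change of variables in a lower integral over an interval:
`∫⁻_{(a, b)} g(t₀ + β s) ds = β⁻¹ ∫⁻_{(t₀ + βa, t₀ + βb)} g` (`β > 0`; push-forward of Lebesgue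
measure, no measurability of `g` needed). [folklore] -/
theorem setLIntegral_Ioo_comp_time_affine {β : ℝ} (hβ : 0 < β) (t₀ a b : ℝ) (g : ℝ → ℝ≥0∞) :
    ∫⁻ s in Ioo a b, g (t₀ + β * s) =
      ENNReal.ofReal β⁻¹ * ∫⁻ t in Ioo (t₀ + β * a) (t₀ + β * b), g t := by
  have hme := measurableEmbedding_time_affine hβ.ne' t₀
  have h1 := hme.restrict_map (volume : Measure ℝ) (Ioo (t₀ + β * a) (t₀ + β * b))
  rw [time_affine_preimage_Ioo hβ, map_time_affine_volume hβ, Measure.restrict_smul] at h1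
  have h2 := hme.lintegral_map (μ := volume.restrict (Ioo a b)) g
  rw [← h1, lintegral_smul_measure, smul_eq_mul] at h2
  exact h2.symm

/-- Space scaling of the cubic slice integral: for the rescaled field
`w_a(s, y) = a w(t₀ + a² s, x₀ + a y)`, `∫_{B₁} |w_a(s)|³ dy = ∫_{B(x₀, a)} |w(t₀ + a² s)|³ dx`
(the weight `a³` of `|a w|³` cancels the Jacobian `a⁻³`). [folklore] -/
theorem setLIntegral_ball_cube_nsZoom {a : ℝ} (ha : 0 < a) (z : ℝ × EuclideanSpace ℝ (Fin 3))
    (u : ℝ → EuclideanSpace ℝ (Fin 3) → EuclideanSpace ℝ (Fin 3)) (s : ℝ) :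
    ∫⁻ y in ball (0 : EuclideanSpace ℝ (Fin 3)) 1,
        ‖(a • stPull (a ^ 2) a z.1 z.2 u) s y‖ₑ ^ (3 : ℕ) =
      ∫⁻ x in ball z.2 a, ‖u (z.1 + a ^ 2 * s) x‖ₑ ^ (3 : ℕ) := by
  have h1 : ∀ y : EuclideanSpace ℝ (Fin 3), ‖(a • stPull (a ^ 2) a z.1 z.2 u) s y‖ₑ ^ (3 : ℕ) =
      ENNReal.ofReal a ^ (3 : ℕ) * ‖u (z.1 + a ^ 2 * s) (z.2 + a • y)‖ₑ ^ (3 : ℕ) := by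
    intro y
    simp only [Pi.smul_apply, stPull_apply, enorm_smul, mul_pow, Real.enorm_eq_ofReal ha.le]
  simp_rw [h1]
  rw [lintegral_const_mul' _ _ (by simp)]
  have hpre : (fun y : EuclideanSpace ℝ (Fin 3) => z.2 + a • y) ⁻¹' ball z.2 a =
      ball (0 : EuclideanSpace ℝ (Fin 3)) 1 := by
    have := space_affine_preimage_ball_zoom ha z.2 (0 : EuclideanSpace ℝ (Fin 3)) 1
    simpa using this
  have h2 := setLIntegral_preimage_comp_space_affine ha z.2
    (fun x : EuclideanSpace ℝ (Fin 3) => ‖u (z.1 + a ^ 2 * s) x‖ₑ ^ (3 : ℕ)) (ball z.2 a)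
  rw [hpre, finrank_euclideanSpace_fin] at h2
  rw [h2, ← mul_assoc, ← ENNReal.ofReal_pow ha.le, ENNReal.ofReal_inv_of_pos (by positivity),
    ENNReal.mul_inv_cancel (by simp [ha]) ENNReal.ofReal_ne_top, one_mul]

/-- **Scaling law of the mixed norm.** For `a > 0` and the rescaled field
`w_a(s, y) = a w(t + a² s, x + a y)`, `z = (t, x)`:
`∫_{-1}^0 (∫_{B₁} |w_a|³ dy)^{4/3} ds = a⁻² ∫_{t-a²}^{t} (∫_{B(x,a)} |w|³ dx)^{4/3} dt`.
[folklore] -/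
theorem lintegral_cube_fourThirds_nsZoom {a : ℝ} (ha : 0 < a) (z : ℝ × EuclideanSpace ℝ (Fin 3))
    (u : ℝ → EuclideanSpace ℝ (Fin 3) → EuclideanSpace ℝ (Fin 3)) :
    ∫⁻ s in Ioo (-1 : ℝ) 0, (∫⁻ y in ball (0 : EuclideanSpace ℝ (Fin 3)) 1,
        ‖(a • stPull (a ^ 2) a z.1 z.2 u) s y‖ₑ ^ (3 : ℕ)) ^ (4 / 3 : ℝ) =
      (ENNReal.ofReal a ^ 2)⁻¹ * ∫⁻ t in Ioo (z.1 - a ^ 2) z.1,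
        (∫⁻ x in ball z.2 a, ‖u t x‖ₑ ^ (3 : ℕ)) ^ (4 / 3 : ℝ) := by
  have ha2 : 0 < a ^ 2 := by positivity
  simp_rw [setLIntegral_ball_cube_nsZoom ha z u]
  rw [setLIntegral_Ioo_comp_time_affine ha2 z.1 (-1) 0
      (fun t => (∫⁻ x in ball z.2 a, ‖u t x‖ₑ ^ (3 : ℕ)) ^ (4 / 3 : ℝ)),
    mul_neg_one, ← sub_eq_add_neg, mul_zero, add_zero, ENNReal.ofReal_inv_of_pos ha2,
    ENNReal.ofReal_pow ha.le]

/-! ### The estimate at unit scale -/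

/-- **(2.10) at unit scale.** There is an absolute `C₁` such that for every field `w` with weak
spatial gradient `G` on `Q₁(0) = (-1, 0) × B₁` and `A(1) ≤ K`, `E(1) ≤ K`:
`∫_{-1}^0 (∫_{B₁} |w|³)^{4/3} ≤ C₁ K²`. Slice-wise Sobolev `H¹(B₁) ⊂ L⁶(B₁)` and the Lebesgue
interpolation `‖w‖_{L³} ≤ ‖w‖_{L²}^{1/2} ‖w‖_{L⁶}^{1/2}` give
`(∫_{B₁} |w(s)|³)^{4/3} ≤ (2C_S)² A (a(s) + e(s))`, which integrates to `(2C_S)² A (A + E)`.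
[cite: Seregin2020, proof of Thm 2.1, (2.10)] -/
theorem exists_lintegral_cube_fourThirds_unit_le :
    ∃ C₁ : ℝ≥0, ∀ (u : ℝ → EuclideanSpace ℝ (Fin 3) → EuclideanSpace ℝ (Fin 3))
      (G : ℝ → EuclideanSpace ℝ (Fin 3) → EuclideanSpace ℝ (Fin 3) →L[ℝ] EuclideanSpace ℝ (Fin 3))
      (K : ℝ≥0∞),
      HasWeakSpatialGradientOn (parabolicCylinderOpens 1 0) u G →
      cknAEss 1 0 u ≤ K → cknE 1 0 G ≤ K →
      ∫⁻ s in Ioo (-1 : ℝ) 0, (∫⁻ y in ball (0 : EuclideanSpace ℝ (Fin 3)) 1,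
          ‖u s y‖ₑ ^ (3 : ℕ)) ^ (4 / 3 : ℝ) ≤ C₁ * K ^ 2 := by
  obtain ⟨CS, hCS⟩ := exists_eLpNorm_six_le_unitBall
  refine ⟨2 * (2 * CS) ^ 2 + 1, fun u G K h hA hE => ?_⟩
  -- the degenerate case `K = ∞`
  rcases eq_or_ne K ∞ with hK | hK
  · rw [hK, ENNReal.top_pow two_ne_zero, ENNReal.mul_top (by positivity)]
    exact le_top
  -- notation
  set B : Set (EuclideanSpace ℝ (Fin 3)) := ball 0 1 with hB
  set I : Set ℝ := Ioo (-1) 0 with hI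
  set a : ℝ → ℝ≥0∞ := fun t => ∫⁻ x in B, ‖u t x‖ₑ ^ 2 with ha
  set e : ℝ → ℝ≥0∞ := fun t => ∫⁻ x in B, ENNReal.ofReal (frobeniusNormSq (G t x)) with he
  set c : ℝ → ℝ≥0∞ := fun t => ∫⁻ x in B, ‖u t x‖ₑ ^ (3 : ℕ) with hc
  have hQ : parabolicCylinder 1 (0 : ℝ × EuclideanSpace ℝ (Fin 3)) = I ×ˢ B := by
    simp [parabolicCylinder, hI, hB]
  have hQI : Ioo ((0 : ℝ × EuclideanSpace ℝ (Fin 3)).1 - 1 ^ 2)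
      (0 : ℝ × EuclideanSpace ℝ (Fin 3)).1 = I := by
    simp [hI]
  -- the quantities at unit scale
  have hAeq : cknAEss 1 0 u = essSup a (volume.restrict I) := by
    simp only [cknAEss, ENNReal.ofReal_one, inv_one, one_mul, hQI]
    rfl
  have hEeq : cknE 1 0 G = ∫⁻ q in I ×ˢ B, ENNReal.ofReal (frobeniusNormSq (G q.1 q.2)) := by
    simp only [cknE, ENNReal.ofReal_one, inv_one, one_mul, hQ]
  -- measurability on the cylinder
  have hQsub : I ×ˢ B ⊆ ((parabolicCylinderOpens 1 (0 : ℝ × EuclideanSpace ℝ (Fin 3)) :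
      Opens (ℝ × EuclideanSpace ℝ (Fin 3))) : Set (ℝ × EuclideanSpace ℝ (Fin 3))) := by
    rw [coe_parabolicCylinderOpens, hQ]
  have hum : AEStronglyMeasurable (uncurry u) (volume.restrict (I ×ˢ B)) :=
    (h.locallyIntegrableOn.mono_set hQsub).aestronglyMeasurable
  have hGm : AEStronglyMeasurable (uncurry G) (volume.restrict (I ×ˢ B)) :=
    (h.locallyIntegrableOn_grad.mono_set hQsub).aestronglyMeasurable
  have hprod : (volume.restrict (I ×ˢ B) : Measure (ℝ × EuclideanSpace ℝ (Fin 3))) =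
      (volume.restrict I).prod (volume.restrict B) := by
    rw [Measure.volume_eq_prod, Measure.prod_restrict]
  have hum2 : AEMeasurable (fun q : ℝ × EuclideanSpace ℝ (Fin 3) => ‖u q.1 q.2‖ₑ ^ (2 : ℕ))
      ((volume.restrict I).prod (volume.restrict B)) := by
    rw [← hprod]; exact (hum.enorm.pow_const 2)
  have hGm2 : AEMeasurable (fun q : ℝ × EuclideanSpace ℝ (Fin 3) =>
      ENNReal.ofReal (frobeniusNormSq (G q.1 q.2)))
      ((volume.restrict I).prod (volume.restrict B)) := by
    rw [← hprod]
    exact (continuous_frobeniusNormSq'.comp_aestronglyMeasurable hGm).aemeasurable.ennreal_ofReal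
  -- Tonelli
  have hEeq' : cknE 1 0 G = ∫⁻ t in I, e t := by
    rw [hEeq, Measure.volume_eq_prod, setLIntegral_prod _ (by rwa [← Measure.prod_restrict])]
  have ham : AEMeasurable a (volume.restrict I) := hum2.lintegral_prod_right'
  -- a.e. in time: energy bound, finite dissipation, weak derivative of the slice
  set A := cknAEss 1 0 u with hAdef
  set EE := cknE 1 0 G with hEdef
  have hAtop : A ≠ ∞ := ne_top_of_le_ne_top hK hA
  have hEtop : EE ≠ ∞ := ne_top_of_le_ne_top hK hE
  have h1 : ∀ᵐ t ∂(volume.restrict I), a t ≤ A := by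
    rw [hAeq]; exact ENNReal.ae_le_essSup a
  have hem : AEMeasurable e (volume.restrict I) := hGm2.lintegral_prod_right'
  have h2 : ∀ᵐ t ∂(volume.restrict I), e t < ∞ := by
    refine ae_lt_top' hem ?_
    rw [← hEeq']; exact hEtop
  have h3 : ∀ᵐ t ∂(volume.restrict I), Literature.Analysis.FunctionSpaces.HasWeakFDerivOn
      (⟨B, isOpen_ball⟩ : Opens (EuclideanSpace ℝ (Fin 3))) volume (u t) (G t) := by
    have := h.ae_hasWeakFDerivOn_ball
    rwa [hQI] at this
  -- the pointwise-in-time estimate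
  have hpt : ∀ᵐ t ∂(volume.restrict I),
      c t ^ (4 / 3 : ℝ) ≤ A * ((2 * CS : ℝ≥0) : ℝ≥0∞) ^ (2 : ℝ) * (a t + e t) := by
    filter_upwards [h1, h2, h3] with t hat het hwt
    have hat' : a t ≠ ∞ := ne_top_of_le_ne_top hAtop hat
    -- measurability of the slice
    have hutm : AEStronglyMeasurable (u t) (volume.restrict B) :=
      hwt.locallyIntegrableOn.aestronglyMeasurable
    -- `‖u t‖_{L²(B)} = a(t)^{1/2}`
    have hL2 : eLpNorm (u t) 2 (volume.restrict B) = a t ^ (1 / 2 : ℝ) := by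
      rw [eLpNorm_eq_lintegral_rpow_enorm_toReal two_ne_zero ENNReal.ofNat_ne_top,
        ENNReal.toReal_ofNat, ha]
      simp only [one_div]
      congr 1
      refine lintegral_congr fun x => ?_
      rw [show (2 : ℝ) = ((2 : ℕ) : ℝ) by norm_num, ENNReal.rpow_natCast]
    have hL2' : eLpNorm (u t) 2 (volume.restrict B) ≠ ∞ := by
      rw [hL2]; exact ENNReal.rpow_ne_top_of_nonneg (by norm_num) hat'
    -- Sobolev on the slice
    have hS : eLpNorm (u t) 6 (volume.restrict B) ≤
        CS * (a t ^ (1 / 2 : ℝ) + e t ^ (1 / 2 : ℝ)) := by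
      have := hCS (u t) (G t) hwt hL2'
      rwa [hL2] at this
    have hS2 : eLpNorm (u t) 6 (volume.restrict B) ≤
        ((2 * CS : ℝ≥0) : ℝ≥0∞) * (a t + e t) ^ (1 / 2 : ℝ) := by
      refine hS.trans ?_
      have h1' : a t ^ (1 / 2 : ℝ) ≤ (a t + e t) ^ (1 / 2 : ℝ) :=
        ENNReal.rpow_le_rpow le_self_add (by norm_num)
      have h2' : e t ^ (1 / 2 : ℝ) ≤ (a t + e t) ^ (1 / 2 : ℝ) :=
        ENNReal.rpow_le_rpow le_add_self (by norm_num)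
      calc (CS : ℝ≥0∞) * (a t ^ (1 / 2 : ℝ) + e t ^ (1 / 2 : ℝ))
          ≤ CS * ((a t + e t) ^ (1 / 2 : ℝ) + (a t + e t) ^ (1 / 2 : ℝ)) := by gcongr
        _ = ((2 * CS : ℝ≥0) : ℝ≥0∞) * (a t + e t) ^ (1 / 2 : ℝ) := by push_cast; ring
    -- `(∫ |u t|⁶)^{1/4} = ‖u t‖_{L⁶}^{3/2}`
    have hL6 : (∫⁻ x in B, ‖u t x‖ₑ ^ (6 : ℝ)) ^ (1 / 4 : ℝ) =
        eLpNorm (u t) 6 (volume.restrict B) ^ (3 / 2 : ℝ) := by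
      rw [eLpNorm_eq_lintegral_rpow_enorm_toReal (by norm_num) ENNReal.ofNat_ne_top,
        ENNReal.toReal_ofNat, ← ENNReal.rpow_mul]
      norm_num
    -- Hölder in space
    have hH := lintegral_pow_three_le_Lp_interpolation (volume.restrict B) hutm.enorm
    have hct : c t ≤ A ^ (3 / 4 : ℝ) * (((2 * CS : ℝ≥0) : ℝ≥0∞) ^ (3 / 2 : ℝ) *
        (a t + e t) ^ (3 / 4 : ℝ)) :=
      calc c t ≤ a t ^ (3 / 4 : ℝ) * (∫⁻ x in B, ‖u t x‖ₑ ^ (6 : ℝ)) ^ (1 / 4 : ℝ) := hH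
        _ = a t ^ (3 / 4 : ℝ) * eLpNorm (u t) 6 (volume.restrict B) ^ (3 / 2 : ℝ) := by rw [hL6]
        _ ≤ A ^ (3 / 4 : ℝ) *
            (((2 * CS : ℝ≥0) : ℝ≥0∞) * (a t + e t) ^ (1 / 2 : ℝ)) ^ (3 / 2 : ℝ) := by gcongr
        _ = A ^ (3 / 4 : ℝ) *
            (((2 * CS : ℝ≥0) : ℝ≥0∞) ^ (3 / 2 : ℝ) * (a t + e t) ^ (3 / 4 : ℝ)) := by
          rw [ENNReal.mul_rpow_of_nonneg _ _ (by norm_num), ← ENNReal.rpow_mul]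
          norm_num
    -- raise to the power `4/3`
    calc c t ^ (4 / 3 : ℝ)
        ≤ (A ^ (3 / 4 : ℝ) * (((2 * CS : ℝ≥0) : ℝ≥0∞) ^ (3 / 2 : ℝ) *
            (a t + e t) ^ (3 / 4 : ℝ))) ^ (4 / 3 : ℝ) := ENNReal.rpow_le_rpow hct (by norm_num)
      _ = A * ((2 * CS : ℝ≥0) : ℝ≥0∞) ^ (2 : ℝ) * (a t + e t) := by
          rw [ENNReal.mul_rpow_of_nonneg _ _ (by norm_num),
            ENNReal.mul_rpow_of_nonneg _ _ (by norm_num), ← ENNReal.rpow_mul, ← ENNReal.rpow_mul,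
            ← ENNReal.rpow_mul, mul_assoc]
          norm_num
  -- integrate in time
  have hKc : A * ((2 * CS : ℝ≥0) : ℝ≥0∞) ^ (2 : ℝ) ≠ ∞ :=
    ENNReal.mul_ne_top hAtop (ENNReal.rpow_ne_top_of_nonneg (by norm_num) ENNReal.coe_ne_top)
  have hvolI : (volume.restrict I : Measure ℝ) univ ≤ 1 := by
    rw [Measure.restrict_apply_univ, hI, Real.volume_Ioo]; norm_num
  have hint_a : ∫⁻ t in I, a t ≤ A := by
    calc ∫⁻ t in I, a t ≤ ∫⁻ _ in I, A := lintegral_mono_ae h1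
      _ = A * (volume.restrict I) univ := lintegral_const A
      _ ≤ A * 1 := by gcongr
      _ = A := mul_one A
  have hCS2 : ((2 * CS : ℝ≥0) : ℝ≥0∞) ^ (2 : ℝ) = (((2 * CS) ^ 2 : ℝ≥0) : ℝ≥0∞) := by
    rw [show (2 : ℝ) = ((2 : ℕ) : ℝ) by norm_num, ENNReal.rpow_natCast, ENNReal.coe_pow]
  calc ∫⁻ t in I, c t ^ (4 / 3 : ℝ)
      ≤ ∫⁻ t in I, A * ((2 * CS : ℝ≥0) : ℝ≥0∞) ^ (2 : ℝ) * (a t + e t) := lintegral_mono_ae hpt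
    _ = A * ((2 * CS : ℝ≥0) : ℝ≥0∞) ^ (2 : ℝ) * ∫⁻ t in I, (a t + e t) := by
        rw [← lintegral_const_mul' _ _ hKc]
    _ ≤ A * ((2 * CS : ℝ≥0) : ℝ≥0∞) ^ (2 : ℝ) * (A + EE) := by
        gcongr
        rw [lintegral_add_left' ham, ← hEeq']
        gcongr
    _ ≤ K * ((2 * CS : ℝ≥0) : ℝ≥0∞) ^ (2 : ℝ) * (K + K) := by gcongr
    _ = (((2 * (2 * CS) ^ 2 : ℝ≥0)) : ℝ≥0∞) * K ^ 2 := by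
        rw [hCS2, ← two_mul]; push_cast; ring
    _ ≤ ((2 * (2 * CS) ^ 2 + 1 : ℝ≥0) : ℝ≥0∞) * K ^ 2 := by
        gcongr
        exact_mod_cast le_self_add

/-! ### Arbitrary cylinders by the Navier–Stokes scaling -/

/-- **Seregin 2020, (2.10), at every scale and centre.** There is an absolute constant `C₀` such
that for every field `w` with weak spatial gradient `G` on the parabolic cylinder
`Q(z, a) = (t - a², t) × B(x, a)`, `a > 0`, whose scaled energy and dissipation satisfy
`A(w; Q(z,a)) = cknAEss a z w ≤ K` and `E(G; Q(z,a)) = cknE a z G ≤ K`,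
`∫_{t-a²}^{t} (∫_{B(x,a)} |w(s,y)|³ dy)^{4/3} ds ≤ C₀ a² K²`; equivalently
`a^{-1/2} ‖w‖_{L⁴_t L³_x(Q(z,a))} ≤ C₀^{1/4} K^{1/2}`. From the unit scale by the scaling
`w ↦ a w(t + a² s, x + a y)`. [cite: Seregin2020, proof of Thm 2.1, (2.10)] -/
theorem exists_lintegral_cube_fourThirds_le :
    ∃ C₀ : ℝ≥0, ∀ (w : ℝ → EuclideanSpace ℝ (Fin 3) → EuclideanSpace ℝ (Fin 3))
      (G : ℝ → EuclideanSpace ℝ (Fin 3) → EuclideanSpace ℝ (Fin 3) →L[ℝ] EuclideanSpace ℝ (Fin 3))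
      (z : ℝ × EuclideanSpace ℝ (Fin 3)) (a : ℝ) (K : ℝ≥0∞), 0 < a →
      HasWeakSpatialGradientOn (parabolicCylinderOpens a z) w G →
      cknAEss a z w ≤ K → cknE a z G ≤ K →
      ∫⁻ s in Ioo (z.1 - a ^ 2) z.1, (∫⁻ y in ball z.2 a, ‖w s y‖ₑ ^ (3 : ℕ)) ^ (4 / 3 : ℝ) ≤
        C₀ * ENNReal.ofReal a ^ 2 * K ^ 2 := by
  obtain ⟨C₁, hC₁⟩ := exists_lintegral_cube_fourThirds_unit_le
  refine ⟨C₁, fun w G z a K ha h hA hE => ?_⟩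
  have ha2 : 0 < a ^ 2 := by positivity
  -- the rescaled pair on `Q₁(0)`
  have hz : stAffine (a ^ 2) a z.1 z.2 (0 : ℝ × EuclideanSpace ℝ (Fin 3)) = z :=
    Prod.ext (by simp [stAffine]) (by simp [stAffine])
  have hAe : cknAEss 1 0 (a • stPull (a ^ 2) a z.1 z.2 w) = cknAEss a z w := by
    simpa [hz] using cknAEss_nsZoom ha one_pos z.1 z.2 0 w
  have hEe : cknE 1 0 (a ^ 2 • stPull (a ^ 2) a z.1 z.2 G) = cknE a z G := by
    simpa [hz] using cknE_nsZoom ha one_pos z.1 z.2 0 G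
  have hw : HasWeakSpatialGradientOn (parabolicCylinderOpens 1 0) (a • stPull (a ^ 2) a z.1 z.2 w)
      (a ^ 2 • stPull (a ^ 2) a z.1 z.2 G) := by
    have := h.stRescale a ha2 ha z.1 z.2
    rwa [stPreimage_parabolicCylinderOpens_self ha, ← sq] at this
  have key := hC₁ _ _ K hw (by rwa [hAe]) (by rwa [hEe])
  rw [lintegral_cube_fourThirds_nsZoom ha z w] at key
  have ha0 : ENNReal.ofReal a ^ 2 ≠ 0 := by simp [ha]
  have hatop : ENNReal.ofReal a ^ 2 ≠ ∞ := ENNReal.pow_ne_top ENNReal.ofReal_ne_top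
  calc ∫⁻ s in Ioo (z.1 - a ^ 2) z.1, (∫⁻ y in ball z.2 a, ‖w s y‖ₑ ^ (3 : ℕ)) ^ (4 / 3 : ℝ)
      = ENNReal.ofReal a ^ 2 * ((ENNReal.ofReal a ^ 2)⁻¹ *
          ∫⁻ s in Ioo (z.1 - a ^ 2) z.1,
            (∫⁻ y in ball z.2 a, ‖w s y‖ₑ ^ (3 : ℕ)) ^ (4 / 3 : ℝ)) := by
        rw [← mul_assoc, ENNReal.mul_inv_cancel ha0 hatop, one_mul]
    _ ≤ ENNReal.ofReal a ^ 2 * (C₁ * K ^ 2) := by gcongr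
    _ = C₁ * ENNReal.ofReal a ^ 2 * K ^ 2 := by ring

/-- **Seregin 2020, proof of Thm 2.1, (2.10): the scaled `L⁴_t L³_x` bound of a field from its
scaled energy `A` and dissipation `E`**, origin-centred form consumed for the ancient blow-up
limit (whose `A(w; a) ≤ K`, `E(G; a) ≤ K` at every scale `a > 0` are property (𝒜)(iii)): there is
an absolute constant `C₀` such that, whenever `w` has the weak spatial gradient `G'` on
`Q(a) = (-a², 0) × B(0, a)` with `cknAEss a 0 w ≤ K` and `cknE a 0 G' ≤ K`,
`∫_{-a²}^0 (∫_{B(0,a)} |w|³ dy)^{4/3} ds ≤ C₀ a² K²`, i.e.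
`sup_{a>0} a^{-1/2} ‖w‖_{L⁴_t L³_x(Q(a))} ≤ C₀^{1/4} K^{1/2} = c(L₀)`.
[cite: Seregin2020, proof of Thm 2.1, (2.10)] -/
theorem lintegral_cube_fourThirds_le_of_cknAEss_cknE :
    ∃ C₀ : ℝ≥0, ∀ (w : ℝ → EuclideanSpace ℝ (Fin 3) → EuclideanSpace ℝ (Fin 3))
      (G' : ℝ → EuclideanSpace ℝ (Fin 3) → EuclideanSpace ℝ (Fin 3) →L[ℝ] EuclideanSpace ℝ (Fin 3))
      (a : ℝ) (K : ℝ≥0∞), 0 < a →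
      HasWeakSpatialGradientOn
        (parabolicCylinderOpens a (0 : ℝ × EuclideanSpace ℝ (Fin 3))) w G' →
      cknAEss a (0 : ℝ × EuclideanSpace ℝ (Fin 3)) w ≤ K →
      cknE a (0 : ℝ × EuclideanSpace ℝ (Fin 3)) G' ≤ K →
      ∫⁻ s in Ioo (-a ^ 2) 0, (∫⁻ y in ball (0 : EuclideanSpace ℝ (Fin 3)) a,
          ‖w s y‖ₑ ^ (3 : ℕ)) ^ (4 / 3 : ℝ) ≤ C₀ * ENNReal.ofReal a ^ 2 * K ^ 2 := by
  obtain ⟨C₀, hC₀⟩ := exists_lintegral_cube_fourThirds_le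
  refine ⟨C₀, fun w G' a K ha h hA hE => ?_⟩
  have := hC₀ w G' 0 a K ha h hA hE
  simpa only [Prod.fst_zero, Prod.snd_zero, zero_sub] using this

end Summit.NavierStokesRegularity.NavierStokesRegularity.Theorems.AxisymmetricKatoGlobal.EulerScaling

end
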